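import Summits.ResolutionOfSingularities.ResolutionOfSingularities.Theorems.PurelyInseparableDim4Spivakovsky
import Summits.ResolutionOfSingularities.ResolutionOfSingularities.Theorems.PurelyInseparableDim4PolyhedraGame
import HarnessLib

/-!
# [OURS · res-dim4-pi PR-9c, part 5] The NEED-FACT discharged: `PolyhedraGame.WeakWin σ I` holds

Cell `res-dim4-pi` (D-0157 DOOR 2), brick **PR-9c** (desk WORD #25 (e): consortium p-11 (lead) · p-5 · p-10 · p-14).
Def-free.  `PolyhedraGame.WeakWin σ I` (seat p-10, `PurelyInseparableDim4PolyhedraGame`) is Spivakovsky's theorem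
for Hironaka's ORIGINAL polyhedra game in the coordinates `I`, stated on lattice positions with threshold `t` and
the PRINTED (weak) end of the game, and was recorded there as a NAMED HYPOTHESIS.  Here it is PROVED, for every
index type `σ` and every finite `I`, from the generator-set transcription of Spivakovsky's strategy
(`…SpivakovskyDefs/Strategy/Move/OneVertex/Spivakovsky`): a lattice position `P ⊂ ℕ^σ` is read as the rational
position `{(a|_I)/t}` over the index type `↥I`; the strategy's choice there is a permissible `J ⊆ I` for `P`; if A
could not force the weak win from `P`, player B would have answers keeping A from forcing it for ever, i.e. an
infinite strategy play with denominators `t` and `d ≥ 1` — excluded by `Spivakovsky.no_strategy_play'`.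
[cite: Spivakovsky1983, Theorem p. 421 (§I); §§II–III]

* `PolyhedraGame.weakWin_holds (σ) (I) : PolyhedraGame.WeakWin σ I` — **Spivakovsky's theorem (1983)**;
  with p-10's `forces_strict_of_weakWin` and `purePositionalWin4_of_weakWin`, p-14's positional extraction,
  p-10's PR-9a and p-7's PR-9b this makes the frame's F4-S `SpineTerminatesSomeRule p q` unconditional.

[OURS · counted 0 · AI work weaker than expert review] A kernel proof of a 1983 combinatorial theorem about OUR
frame's spine game; NOTHING here is a theorem about resolution of singularities in dimension ≥ 4 / characteristic
`p`. bears_on: LADDER-RESOLUTION:D157-DOOR2 (res-dim4-pi · PR-9c). Supports stmt-ResolutionOfSingularities-16155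
(helper).
-/

set_option linter.dupNamespace false -- mandated namespace of this single-conjunct summit

open Finset
open scoped BigOperators

namespace Summit.ResolutionOfSingularities.ResolutionOfSingularities.Theorems.PIDim4

namespace PolyhedraGame

open Literature.AlgebraicGeometry.Resolution
open Literature.AlgebraicGeometry.Resolution.CentreBlowup

variable {σ : Type} [DecidableEq σ]

section Bridge

variable {I : Finset σ} {t : ℕ}

omit [DecidableEq σ] in
/-- Sum of the rational reading over `Γ' ⊆ ↥I` is `(Σ_{j ∈ Γ'.map subtype} a_j) / t`. [folklore] -/
theorem sum_scale_eq (a : σ →₀ ℕ) (Γ' : Finset I) :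
    ∑ k ∈ Γ', (a k.1 : ℚ) / t = (degIn (Γ'.map (Function.Embedding.subtype _)) a : ℚ) / t := by
  rw [degIn, Finset.sum_map, Nat.cast_sum, Finset.sum_div]
  rfl

omit [DecidableEq σ] in
/-- Over all of `↥I` the rational reading sums to `(degIn I a) / t`. [folklore] -/
theorem sum_scale_univ (a : σ →₀ ℕ) :
    ∑ k : I, (a k.1 : ℚ) / t = (degIn I a : ℚ) / t := by
  rw [degIn, Nat.cast_sum, Finset.sum_div, Finset.sum_coe_sort I (fun j => (a j : ℚ) / t)]

/-- It is good on `univ` when `P ≠ ∅`. [folklore] -/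
theorem good_image_scale {P : Pos σ} (hP : P.Nonempty) :
    Spivakovsky.Good (Finset.univ : Finset I) (P.image (fun (a : σ →₀ ℕ) (k : I) => (a k.1 : ℚ) / t)) := by
  refine ⟨hP.image _, fun g hg k => ?_, fun g _ k hk => absurd (Finset.mem_univ k) hk⟩
  obtain ⟨a, _, rfl⟩ := Finset.mem_image.mp hg
  positivity

/-- Its denominators are bounded by `t`. [folklore] -/
theorem den_image_scale {P : Pos σ} (ht : 0 < t) :
    Spivakovsky.Den t (P.image (fun (a : σ →₀ ℕ) (k : I) => (a k.1 : ℚ) / t)) := by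
  intro g hg k
  obtain ⟨a, _, rfl⟩ := Finset.mem_image.mp hg
  refine ⟨a k.1, ?_⟩
  have htq : (t : ℚ) ≠ 0 := by exact_mod_cast ht.ne'
  field_simp
  push_cast
  ring

/-- If A has not yet (weakly) won, `d ≥ 1` for the rational position. [folklore] -/
theorem one_le_dG_image_scale {P : Pos σ} (ht : 0 < t) (hW : ¬ WeakWon t I P) :
    1 ≤ Spivakovsky.dG (Finset.univ : Finset I) (P.image (fun (a : σ →₀ ℕ) (k : I) => (a k.1 : ℚ) / t)) := by
  have hP : P.Nonempty := by
    rw [Finset.nonempty_iff_ne_empty]; exact fun h => hW (Or.inl h)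
  apply Spivakovsky.le_dG _ (hP.image _)
  intro g hg
  obtain ⟨a, ha, rfl⟩ := Finset.mem_image.mp hg
  have hlt : t < degIn I a := by
    by_contra hle; push Not at hle; exact hW (Or.inr ⟨a, ha, hle⟩)
  have htq : (0 : ℚ) < t := by exact_mod_cast ht
  rw [sum_scale_univ, le_div_iff₀ htq, one_mul]
  exact_mod_cast hlt.le

/-- A set permissible for the rational position gives a permissible `J ⊆ I` for the lattice position.
[cite: Spivakovsky1983, §I (permissible Γ)] -/
theorem permissible_map_of_perm {P : Pos σ} (ht : 0 < t) {Γ' : Finset I}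
    (hΓ : Spivakovsky.Perm Γ' (P.image (fun (a : σ →₀ ℕ) (k : I) => (a k.1 : ℚ) / t))) :
    Permissible t (Γ'.map (Function.Embedding.subtype _)) P := by
  refine ⟨hΓ.1.map, fun a ha => ?_⟩
  have h1 := hΓ.2 _ (Finset.mem_image_of_mem _ ha)
  have htq : (0 : ℚ) < t := by exact_mod_cast ht
  rw [sum_scale_eq, le_div_iff₀ htq, one_mul] at h1
  exact_mod_cast h1

omit [DecidableEq σ] in
/-- `Γ'.map subtype ⊆ I`. [folklore] -/
theorem map_subtype_subset (Γ' : Finset I) : Γ'.map (Function.Embedding.subtype _) ⊆ I := by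
  intro j hj
  obtain ⟨k, _, rfl⟩ := Finset.mem_map.mp hj
  exact k.2

/-- **The move commutes with the rational reading**: for `t ≤ Σ_J a`,
`(chartExponent t J j a)|_I / t = σ_{Γ',j}(a|_I / t)` with `J = Γ'.map subtype`, `j ∈ I`.
[cite: Spivakovsky1983, §I (the transformation σ_{Γ,i})] -/
theorem scale_chartExponent (ht : 0 < t) {Γ' : Finset I} {j : I} {a : σ →₀ ℕ}
    (ha : t ≤ degIn (Γ'.map (Function.Embedding.subtype _)) a) :
    (fun k : I => ((chartExponent t (Γ'.map (Function.Embedding.subtype _)) j.1 a) k.1 : ℚ) / t) =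
      Spivakovsky.move Γ' j (fun k : I => (a k.1 : ℚ) / t) := by
  have htq : (t : ℚ) ≠ 0 := by exact_mod_cast ht.ne'
  funext k
  by_cases hk : k = j
  · subst hk
    rw [Spivakovsky.move_apply_self, chartExponent_apply_self, Nat.cast_sub ha, sum_scale_eq, sub_div,
      div_self htq]
  · have hk' : k.1 ≠ j.1 := fun h => hk (Subtype.ext h)
    rw [Spivakovsky.move_apply_of_ne _ hk, chartExponent_apply_of_ne t _ hk']

end Bridge

/-- **SPIVAKOVSKY'S THEOREM (1983)** — «There exists a winning strategy of A for any given Δ» — for Hironaka's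
original polyhedra game in the coordinates `I` on lattice positions: from every position player A forces the
(printed, weak) win.  Discharges the named hypothesis `PolyhedraGame.WeakWin`.
[cite: Spivakovsky1983, Theorem p. 421 (§I), proof §§II–III] -/
theorem weakWin_holds (σ : Type) [DecidableEq σ] (I : Finset σ) : WeakWin σ I := by
  intro t ht P
  by_contra hP
  -- the rational reading over the index type `↥I`
  let φ : (σ →₀ ℕ) → (I → ℚ) := fun a k => (a k.1 : ℚ) / t
  let G : Pos σ → Spivakovsky.Pos I := fun R => R.image φ
  let Γ : Pos σ → Finset I := fun R => Spivakovsky.strat (Finset.univ : Finset I) (G R)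
  let J : Pos σ → Finset σ := fun R => (Γ R).map (Function.Embedding.subtype _)
  -- from a non-forcing position, the strategy's move has a non-forcing answer
  have key : ∀ R : Pos σ, ¬ Forces (WeakWon t I) t I R →
      ∃ j : I, j ∈ Γ R ∧ ¬ Forces (WeakWon t I) t I (move t (J R) j.1 R) := by
    intro R hR
    have hW : ¬ WeakWon t I R := fun h => hR (Forces.won h)
    have hP' : R.Nonempty := by
      rw [Finset.nonempty_iff_ne_empty]; exact fun h => hW (Or.inl h)
    have hperm : Spivakovsky.Perm (Γ R) (G R) :=
      Spivakovsky.perm_strat (good_image_scale hP') (one_le_dG_image_scale ht hW)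
    have hJperm : Permissible t (J R) R := permissible_map_of_perm ht hperm
    by_contra hall
    push Not at hall
    apply hR
    refine Forces.step (J R) (map_subtype_subset _) hJperm fun j hj => ?_
    obtain ⟨k, hk, rfl⟩ := Finset.mem_map.mp hj
    exact hall k hk
  choose nxt hnxt_mem hnxt_not using key
  -- the infinite sequence of non-forcing positions
  let R : ℕ → {R : Pos σ // ¬ Forces (WeakWon t I) t I R} :=
    fun l => Nat.rec ⟨P, hP⟩ (fun _ r => ⟨move t (J r.1) (nxt r.1 r.2).1 r.1, hnxt_not r.1 r.2⟩) l
  have hR0 : (R 0).1 = P := rfl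
  have hRs : ∀ l, (R (l + 1)).1 = move t (J (R l).1) (nxt (R l).1 (R l).2).1 (R l).1 := fun l => rfl
  -- its rational reading is a strategy play on `univ : Finset ↥I` with denominators `t` and `d ≥ 1`
  have hW : ∀ l, ¬ WeakWon t I (R l).1 := fun l h => (R l).2 (Forces.won h)
  have hne : ∀ l, ((R l).1).Nonempty := fun l => by
    rw [Finset.nonempty_iff_ne_empty]; exact fun h => hW l (Or.inl h)
  refine Spivakovsky.no_strategy_play' (Finset.univ : Finset I) ht (fun l => G (R l).1)
    (fun l => (nxt (R l).1 (R l).2)) (fun l => good_image_scale (hne l)) (fun l => den_image_scale ht)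
    (fun l => one_le_dG_image_scale ht (hW l)) (fun l => hnxt_mem (R l).1 (R l).2) (fun l => ?_)
  -- the step equation: reading ∘ chart law = strategy move ∘ reading on the (permissible) position
  have hperm : Spivakovsky.Perm (Γ (R l).1) (G (R l).1) :=
    Spivakovsky.perm_strat (good_image_scale (hne l)) (one_le_dG_image_scale ht (hW l))
  have hJperm : Permissible t (J (R l).1) (R l).1 := permissible_map_of_perm ht hperm
  show G (R (l + 1)).1 = (G (R l).1).image _
  rw [hRs l]
  simp only [G, move, Finset.image_image]
  apply Finset.image_congr
  intro a ha
  simp only [Function.comp_apply, φ]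
  exact scale_chartExponent ht (hJperm.2 a ha)

end PolyhedraGame

end Summit.ResolutionOfSingularities.ResolutionOfSingularities.Theorems.PIDim4
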